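import Literature.RingTheory.Elimination.PerturbedCharpoly
import Literature.RingTheory.NoetherNormalization.LinearFamily
import Literature.RingTheory.KrullDimension.AffineCatenary
import Mathlib.RingTheory.Ideal.MinimalPrime.Noetherian
import Mathlib.RingTheory.Ideal.GoingUp
import Mathlib.RingTheory.KrullDimension.Zero
import Mathlib.LinearAlgebra.Dimension.Constructions
import Mathlib.LinearAlgebra.FiniteDimensional.Lemmas
import HarnessLib

/-!
# Components of affine algebraic sets: dimension drop, zero-dimensional sets, linear slices, and a
# bound for the number of top-dimensional components

Topic: `Literature/RingTheory/Elimination`. Point-set / ideal-theoretic bookkeeping behind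
Kronecker's method of successive generic hypersurface sections (as in Bürgisser, TCS 235 (2000),
Lemma 4.3: "there is `a ∈ Δ` with `dim V ∩ Z(G_1, …, G_{j+1}) = m - j - 1`, … `W_ν ⊄ V`") for an
affine algebraic set `W ⊆ Kⁿ` over an algebraically closed field `K`: its irreducible components
are the zero sets of the minimal primes `P` of the vanishing ideal `I(W)`, and the dimension of the
component is `dim K[X]/P`.

* `DimLE W q` — every component of `W` has dimension `≤ q`; `topPrimes W q` — the minimal primes of
  dimension exactly `q`.
* `dimLE_inter_zeroSet` — **dimension drop**: if `g` avoids every top prime then every component of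
  `W ∩ Z(g)` has dimension `≤ q - 1` (catenarity of affine domains, `AffineCatenary.lean`).
* `isMaximal_of_zeroLocus_finite`, `finite_of_dimLE_zero` — a prime with finite zero locus is
  maximal (Nullstellensatz); a set all of whose components have dimension `0` is finite.
* `dimLE_linearZeros` — the common zero set of `r` linearly independent linear forms has all
  components of dimension `≤ n - r` (its coordinate ring is generated by `≤ n - r` elements).
* **`ncard_topPrimes_le`** — if `W` is the zero set of `j` polynomials of degree `< D` and
  `DimLE W q` with `j + q = n`, then `W` has at most `Dⁿ` components of dimension `q`. Proof: linear
  Noether normalisation of `K[X]/I(W)` (`LinearFamily.lean`, pure existence over `K`) gives linear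
  forms `λ_1, …, λ_q`; over a top prime `P` the map `K[t] → K[X]/P` is injective and integral, so by
  lying-over every fibre `λ = c` meets `Z(P)`, and for `c` avoiding finitely many proper closed
  sets the resulting points are pairwise distinct; they are common zeros of the SQUARE system
  `(G, λ - c)` of degree `< D`, whose zero set is finite (integrality), hence number `≤ Dⁿ` by the
  Bézout-type count `card_zeros_le_pow` (`PerturbedCharpoly.lean`).

## References

* P. Bürgisser, *Cook's versus Valiant's hypothesis*, TCS 235 (2000), Lemma 4.3 (p. 80–81).
  [Burgisser2000TCS]
* G.-M. Greuel, G. Pfister, *A Singular Introduction to Commutative Algebra* (2002), Thm. 3.4.1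
  (linear Noether normalisation). [GreuelPfister2002]
-/

noncomputable section

open MvPolynomial

namespace Literature.RingTheory.Elimination

variable {K : Type*} [Field K] {n : ℕ}

/-! ### Vanishing ideals and their minimal primes -/

/-- `DimLE W q`: every irreducible component of `W ⊆ Kⁿ` (= minimal prime of `I(W)`) has
dimension `≤ q`. [folklore] -/
def DimLE (W : Set (Fin n → K)) (q : ℕ) : Prop :=
  ∀ P ∈ (vanishingIdeal K W).minimalPrimes, ringKrullDim (MvPolynomial (Fin n) K ⧸ P) ≤ q

/-- The minimal primes of `I(W)` of dimension exactly `q` ("top-dimensional components" when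
`DimLE W q`). [folklore] -/
def topPrimes (W : Set (Fin n → K)) (q : ℕ) : Set (Ideal (MvPolynomial (Fin n) K)) :=
  {P | P ∈ (vanishingIdeal K W).minimalPrimes ∧ ringKrullDim (MvPolynomial (Fin n) K ⧸ P) = q}

/-- Vanishing ideals are radical. [folklore] -/
theorem isRadical_vanishingIdeal (W : Set (Fin n → K)) : (vanishingIdeal K W).IsRadical := by
  intro p ⟨k, hk⟩ x hx
  have h := hk x hx
  rw [map_pow] at h
  exact pow_eq_zero_iff'.1 h |>.1

/-- `x ↦ I({x})` is injective. [folklore] -/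
theorem eq_of_vanishingIdeal_singleton_eq {x y : Fin n → K}
    (h : vanishingIdeal K ({x} : Set (Fin n → K)) = vanishingIdeal K {y}) : x = y := by
  funext i
  have hx : (X i - C (x i) : MvPolynomial (Fin n) K) ∈ vanishingIdeal K ({x} : Set (Fin n → K)) := by
    rw [mem_vanishingIdeal_singleton_iff, aeval_eq_eval, map_sub, eval_X, eval_C, sub_self]
  rw [h, mem_vanishingIdeal_singleton_iff, aeval_eq_eval, map_sub, eval_X, eval_C, sub_eq_zero] at hx
  exact hx.symm

/-- Quotients of `K[X_1, …, X_n]` are finitely generated `K`-algebras. [folklore] -/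
theorem finiteType_quotient (I : Ideal (MvPolynomial (Fin n) K)) :
    Algebra.FiniteType K (MvPolynomial (Fin n) K ⧸ I) :=
  Algebra.FiniteType.of_surjective (Ideal.Quotient.mkₐ K I) (Ideal.Quotient.mkₐ_surjective K I)

/-- The dimension of `K[X]/P` (`P` prime) is a natural number. [folklore] -/
theorem exists_ringKrullDim_quotient_eq_nat (P : Ideal (MvPolynomial (Fin n) K)) [P.IsPrime] :
    ∃ s : ℕ, ringKrullDim (MvPolynomial (Fin n) K ⧸ P) = s := by
  haveI := finiteType_quotient (K := K) P
  obtain ⟨s, hs, -⟩ :=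
    Literature.RingTheory.KrullDimension.exists_ringKrullDim_eq_and_trdeg_eq K (MvPolynomial (Fin n) K ⧸ P)
  exact ⟨s, hs⟩

/-- `(s : WithBot ℕ∞) ≤ q` iff `s ≤ q`. [folklore] -/
theorem natCast_withBot_le_iff {s q : ℕ} : ((s : WithBot ℕ∞) ≤ (q : WithBot ℕ∞)) ↔ s ≤ q := by
  constructor
  · intro h; exact_mod_cast h
  · intro h; exact_mod_cast h

/-- **Strict dimension drop along a strict inclusion of primes** `P < P'` of `K[X]`:
`dim K[X]/P' + 1 ≤ dim K[X]/P`. [folklore] -/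
theorem ringKrullDim_quotient_add_one_le_of_lt {P P' : Ideal (MvPolynomial (Fin n) K)} [P.IsPrime]
    (hle : P ≤ P') (hne : P ≠ P') :
    ringKrullDim (MvPolynomial (Fin n) K ⧸ P') + 1 ≤ ringKrullDim (MvPolynomial (Fin n) K ⧸ P) := by
  haveI : IsDomain (MvPolynomial (Fin n) K ⧸ P) := Ideal.Quotient.isDomain P
  have hmap : P'.map (Ideal.Quotient.mk P) ≠ ⊥ := by
    intro h
    apply hne
    refine le_antisymm hle fun p hp => ?_
    have : Ideal.Quotient.mk P p ∈ P'.map (Ideal.Quotient.mk P) := Ideal.mem_map_of_mem _ hp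
    rw [h, Ideal.mem_bot, Ideal.Quotient.eq_zero_iff_mem] at this
    exact this
  have h := Literature.RingTheory.KrullDimension.ringKrullDim_quotient_add_one_le hmap
  rwa [ringKrullDim_eq_of_ringEquiv (DoubleQuot.quotQuotEquivQuotOfLE hle)] at h

/-- **Dimension drop** (Kronecker's step; Bürgisser 2000, proof of Lemma 4.3: "there is `a` such
that `dim W ∩ Z(G_{j+1}) = dim W - 1`"): if every component of `W` has dimension `≤ q` and `g`
lies in no minimal prime of dimension `q`, then every component of `W ∩ Z(g)` has dimension
`≤ q - 1`. [cite: Burgisser2000TCS, Lemma 4.3 (proof) p. 81] -/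
theorem dimLE_inter_zeroSet (W : Set (Fin n → K)) (q : ℕ) (g : MvPolynomial (Fin n) K)
    (hW : DimLE W q) (hg : ∀ P ∈ topPrimes W q, g ∉ P) :
    DimLE (W ∩ {x | eval x g = 0}) (q - 1) := by
  intro P' hP'
  haveI hP'p : P'.IsPrime := hP'.1.1
  have hanti : vanishingIdeal K W ≤ vanishingIdeal K (W ∩ {x | eval x g = 0}) :=
    vanishingIdeal_anti_mono Set.inter_subset_left
  obtain ⟨P, hP, hPP'⟩ := Ideal.exists_minimalPrimes_le (hanti.trans hP'.1.2)
  haveI hPp : P.IsPrime := hP.1.1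
  obtain ⟨s, hs⟩ := exists_ringKrullDim_quotient_eq_nat (K := K) P
  obtain ⟨s', hs'⟩ := exists_ringKrullDim_quotient_eq_nat (K := K) P'
  have hsq : s ≤ q := natCast_withBot_le_iff.1 (hs ▸ hW P hP)
  have hgP' : g ∈ P' := hP'.1.2 (fun x hx => by rw [aeval_eq_eval]; exact hx.2)
  rw [hs']
  by_cases htop : s = q
  · -- `g ∉ P`, `g ∈ P'`: strict inclusion
    have hgP : g ∉ P := hg P ⟨hP, by rw [hs, htop]⟩
    have hne : P ≠ P' := fun h => hgP (h ▸ hgP')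
    have h := ringKrullDim_quotient_add_one_le_of_lt hPP' hne
    rw [hs, hs'] at h
    have : s' + 1 ≤ s := by exact_mod_cast h
    exact natCast_withBot_le_iff.2 (by omega)
  · have h := ringKrullDim_le_of_surjective (Ideal.Quotient.factor hPP')
      (Ideal.Quotient.factor_surjective hPP')
    rw [hs, hs'] at h
    have : s' ≤ s := natCast_withBot_le_iff.1 h
    exact natCast_withBot_le_iff.2 (by omega)

/-- `DimLE` is monotone in the bound. [folklore] -/
theorem DimLE.mono {W : Set (Fin n → K)} {q q' : ℕ} (h : DimLE W q) (hq : q ≤ q') : DimLE W q' :=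
  fun P hP => (h P hP).trans (by exact_mod_cast hq)

section AlgClosed

variable [IsAlgClosed K]

/-- **A prime of `K[X_1, …, X_n]` with finite zero locus is maximal** (`K` algebraically closed):
its zero locus is a single point. [folklore] -/
theorem isMaximal_of_zeroLocus_finite (P : Ideal (MvPolynomial (Fin n) K)) [hP : P.IsPrime]
    (hfin : (zeroLocus K P).Finite) : P.IsMaximal := by
  classical
  obtain ⟨𝔪, h𝔪, hP𝔪⟩ := Ideal.exists_le_maximal P hP.ne_top
  obtain ⟨pt, rfl⟩ := (isMaximal_iff_eq_vanishingIdeal_singleton (I := 𝔪)).1 h𝔪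
  have hpt : pt ∈ zeroLocus K P := fun q hq => (mem_vanishingIdeal_singleton_iff pt q).1 (hP𝔪 hq)
  have hsingle : zeroLocus K P = {pt} := by
    refine Set.eq_singleton_iff_unique_mem.2 ⟨hpt, fun p' hp' => ?_⟩
    by_contra hne
    obtain ⟨j, hj⟩ := Function.ne_iff.1 hne
    set Tj : Finset K := hfin.toFinset.image (fun p => p j) with hTj
    have hab : (X j - C (pt j)) * ∏ c ∈ Tj.erase (pt j), (X j - C c) ∈ P := by
      rw [← IsPrime.vanishingIdeal_zeroLocus (K := K) P]
      intro p hp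
      rw [aeval_eq_eval, map_mul, map_prod]
      by_cases hpj : p j = pt j
      · rw [map_sub, eval_X, eval_C, hpj, sub_self, zero_mul]
      · have hmem : p j ∈ Tj.erase (pt j) :=
          Finset.mem_erase.2 ⟨hpj, Finset.mem_image.2 ⟨p, hfin.mem_toFinset.2 hp, rfl⟩⟩
        rw [Finset.prod_eq_zero hmem (by rw [map_sub, eval_X, eval_C, sub_self]), mul_zero]
    rcases hP.mem_or_mem hab with ha | hb
    · have h := hp' _ ha
      rw [aeval_eq_eval, map_sub, eval_X, eval_C, sub_eq_zero] at h
      exact hj h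
    · have h := (mem_vanishingIdeal_singleton_iff pt _).1 (hP𝔪 hb)
      rw [aeval_eq_eval, map_prod] at h
      obtain ⟨c, hc, hc0⟩ := Finset.prod_eq_zero_iff.1 h
      rw [map_sub, eval_X, eval_C, sub_eq_zero] at hc0
      exact (Finset.mem_erase.1 hc).1 hc0.symm
  have : P = vanishingIdeal K {pt} := by
    rw [← IsPrime.vanishingIdeal_zeroLocus (K := K) P, hsingle]
  rw [this]; infer_instance

/-- A minimal prime of dimension `0` is the ideal of a point. [folklore] -/
theorem exists_eq_vanishingIdeal_of_ringKrullDim_le_zero (P : Ideal (MvPolynomial (Fin n) K))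
    [hP : P.IsPrime] (h : ringKrullDim (MvPolynomial (Fin n) K ⧸ P) ≤ 0) :
    ∃ x : Fin n → K, P = vanishingIdeal K {x} := by
  haveI : IsDomain (MvPolynomial (Fin n) K ⧸ P) := Ideal.Quotient.isDomain P
  haveI : Ring.KrullDimLE 0 (MvPolynomial (Fin n) K ⧸ P) := by
    rw [Ring.krullDimLE_iff]; exact_mod_cast h
  have hf : IsField (MvPolynomial (Fin n) K ⧸ P) := Ring.KrullDimLE.isField_of_isDomain
  have hmax : P.IsMaximal := Ideal.Quotient.maximal_of_isField P hf
  exact (isMaximal_iff_eq_vanishingIdeal_singleton (I := P)).1 hmax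

/-- **Zero-dimensional sets are finite**: if every component of `W` has dimension `≤ 0` then `W` is
finite (the minimal primes of `I(W)` are finitely many point ideals). [folklore] -/
theorem finite_of_dimLE_zero (W : Set (Fin n → K)) (hW : DimLE W 0) : W.Finite := by
  have hfin := Ideal.finite_minimalPrimes_of_isNoetherianRing (MvPolynomial (Fin n) K)
    (vanishingIdeal K W)
  have hpt : ∀ P ∈ (vanishingIdeal K W).minimalPrimes, ∃ x : Fin n → K, P = vanishingIdeal K {x} := by
    intro P hP
    haveI : P.IsPrime := hP.1.1
    exact exists_eq_vanishingIdeal_of_ringKrullDim_le_zero P (hW P hP)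
  choose pt hpt using hpt
  refine (hfin.dependent_image pt).subset ?_
  · intro w hw
    haveI : (vanishingIdeal K ({w} : Set (Fin n → K))).IsPrime := inferInstance
    have hle : vanishingIdeal K W ≤ vanishingIdeal K {w} :=
      vanishingIdeal_anti_mono (Set.singleton_subset_iff.2 hw)
    obtain ⟨P, hP, hPw⟩ := Ideal.exists_minimalPrimes_le hle
    refine ⟨P, hP, ?_⟩
    haveI : P.IsPrime := hP.1.1
    have hPmax : P.IsMaximal := by rw [hpt P hP]; infer_instance
    have heq : P = vanishingIdeal K {w} := hPmax.eq_of_le (Ideal.IsPrime.ne_top inferInstance) hPw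
    rw [hpt P hP] at heq
    exact eq_of_vanishingIdeal_singleton_eq heq

/-- **Top-dimensional components are not covered by a finite set**: if `P` is a minimal prime of
`I(W)` of dimension `q ≥ 1`, `W ⊆ A` with `A` the zero set of a family `ℒ`, and every `S_k` lies in
`P`, then `Z(P) ⊆ Z(S) ∩ A`; so if `Z(S) ∩ A` is finite this is impossible (Bürgisser 2000, proof of
Lemma 4.3: "`W_ν ⊄ V` since `dim W_ν ≥ 1`"). Stated: some `S_k ∉ P`.
[cite: Burgisser2000TCS, Lemma 4.3 (proof) p. 81] -/
theorem exists_not_mem_of_topPrime {ι κ : Type*} (W : Set (Fin n → K)) {q : ℕ} (hq : 1 ≤ q)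
    (S : ι → MvPolynomial (Fin n) K) (ℒ : κ → MvPolynomial (Fin n) K)
    (hWA : W ⊆ {x | ∀ k, eval x (ℒ k) = 0})
    (hfin : ({x | ∀ i, eval x (S i) = 0} ∩ {x | ∀ k, eval x (ℒ k) = 0}).Finite)
    {P : Ideal (MvPolynomial (Fin n) K)} (hP : P ∈ topPrimes W q) : ∃ i, S i ∉ P := by
  by_contra hall
  push Not at hall
  haveI : P.IsPrime := hP.1.1.1
  have hZ : zeroLocus K P ⊆ {x | ∀ i, eval x (S i) = 0} ∩ {x | ∀ k, eval x (ℒ k) = 0} := by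
    intro x hx
    refine ⟨fun i => ?_, fun k => ?_⟩
    · have := hx (S i) (hall i); rwa [aeval_eq_eval] at this
    · have hmem : ℒ k ∈ P := hP.1.1.2 (fun y hy => by rw [aeval_eq_eval]; exact hWA hy k)
      have := hx (ℒ k) hmem; rwa [aeval_eq_eval] at this
  have hmax := isMaximal_of_zeroLocus_finite P (hfin.subset hZ)
  obtain ⟨x, hx⟩ := (isMaximal_iff_eq_vanishingIdeal_singleton (I := P)).1 hmax
  have hdim : ringKrullDim (MvPolynomial (Fin n) K ⧸ P) = 0 := by
    rw [hx]
    exact ringKrullDim_eq_zero_of_isField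
      ((Ideal.Quotient.maximal_ideal_iff_isField_quotient _).1 inferInstance)
  have h := hP.2
  rw [hdim] at h
  have : (q : WithBot ℕ∞) = 0 := h.symm
  have hq0 : q = 0 := by exact_mod_cast this
  omega

end AlgClosed

/-! ### Linear slices -/

/-- The coordinate ring of any `W` is generated by the classes of the variables: `adjoin = ⊤`.
[folklore] -/
theorem adjoin_mk_X_eq_top (I : Ideal (MvPolynomial (Fin n) K)) :
    Algebra.adjoin K (Set.range fun i : Fin n => Ideal.Quotient.mk I (X i)) = ⊤ := by
  have h : (aeval fun i : Fin n => Ideal.Quotient.mk I (X i)) = Ideal.Quotient.mkₐ K I := by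
    refine MvPolynomial.algHom_ext fun i => ?_
    simp
  rw [← aeval_range, h, AlgHom.range_eq_top]
  exact Ideal.Quotient.mkₐ_surjective K I

/-- **Components of a linear slice**: the common zero set of `r` linearly independent linear forms
`L_k = Σ_j L_{kj} x_j` has all components of dimension `≤ n - r` (its coordinate ring is generated
by the classes of the `x_j`, which span a space of dimension `≤ n - r`). [folklore] -/
theorem dimLE_linearZeros {r : ℕ} (L : Fin r → (Fin n → K)) (hL : LinearIndependent K L) :
    DimLE {x : Fin n → K | ∀ k, ∑ j, L k j * x j = 0} (n - r) := by
  classical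
  intro P hP
  set W : Set (Fin n → K) := {x | ∀ k, ∑ j, L k j * x j = 0} with hW
  set I₀ := vanishingIdeal K W with hI₀
  -- the span of the classes of the variables has dimension `≤ n - r`
  set y : Fin n → MvPolynomial (Fin n) K ⧸ I₀ := fun i => Ideal.Quotient.mk I₀ (X i) with hy
  set Φ : (Fin n → K) →ₗ[K] MvPolynomial (Fin n) K ⧸ I₀ := Fintype.linearCombination K y with hΦ
  have hker : Submodule.span K (Set.range L) ≤ LinearMap.ker Φ := by
    rw [Submodule.span_le]
    rintro _ ⟨k, rfl⟩
    rw [SetLike.mem_coe, LinearMap.mem_ker, hΦ, Fintype.linearCombination_apply]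
    have h1 : ∑ j, L k j • y j = Ideal.Quotient.mk I₀ (∑ j, C (L k j) * X j) := by
      rw [map_sum]
      refine Finset.sum_congr rfl fun j _ => ?_
      rw [hy]
      change L k j • Ideal.Quotient.mkₐ K I₀ (X j) = Ideal.Quotient.mkₐ K I₀ (C (L k j) * X j)
      rw [← map_smul, MvPolynomial.smul_eq_C_mul]
    rw [h1, Ideal.Quotient.eq_zero_iff_mem, hI₀]
    intro x hx
    rw [aeval_eq_eval, map_sum]
    simp only [map_mul, eval_C, eval_X]
    exact hx k
  have hrank : Module.finrank K (LinearMap.range Φ) ≤ n - r := by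
    have h1 := LinearMap.finrank_range_add_finrank_ker Φ
    rw [Module.finrank_fin_fun] at h1
    have h2 : r ≤ Module.finrank K (LinearMap.ker Φ) := by
      have := Submodule.finrank_mono hker
      rwa [finrank_span_eq_card hL, Fintype.card_fin] at this
    omega
  set U := LinearMap.range Φ with hU
  set b := Module.finBasis K U with hb
  set ψ : MvPolynomial (Fin (Module.finrank K U)) K →ₐ[K] MvPolynomial (Fin n) K ⧸ I₀ :=
    aeval fun j => ((b j : U) : MvPolynomial (Fin n) K ⧸ I₀) with hψ
  have hyU : ∀ i, y i ∈ U := fun i => by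
    refine ⟨Pi.single i 1, ?_⟩
    rw [hΦ, Fintype.linearCombination_apply_single, one_smul]
  have hsurj : Function.Surjective ψ := by
    rw [← AlgHom.range_eq_top, hψ, aeval_range, eq_top_iff, ← adjoin_mk_X_eq_top I₀,
      Algebra.adjoin_le_iff]
    rintro _ ⟨i, rfl⟩
    have hrepr := b.sum_repr ⟨y i, hyU i⟩
    have : y i = ∑ j, b.repr ⟨y i, hyU i⟩ j • ((b j : U) : MvPolynomial (Fin n) K ⧸ I₀) := by
      have h := congrArg Subtype.val hrepr
      simp only [AddSubmonoidClass.coe_finsetSum, Submodule.coe_smul] at h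
      exact h.symm
    rw [SetLike.mem_coe, show (fun i => (Ideal.Quotient.mk I₀) (X i)) i = y i from rfl, this]
    refine Subalgebra.sum_mem _ fun j _ => Subalgebra.smul_mem _ ?_ _
    exact Algebra.subset_adjoin ⟨j, rfl⟩
  -- dimensions
  have hdimB : ringKrullDim (MvPolynomial (Fin n) K ⧸ I₀) ≤ (n - r : ℕ) := by
    refine (ringKrullDim_le_of_surjective ψ.toRingHom hsurj).trans ?_
    rw [MvPolynomial.ringKrullDim_of_isNoetherianRing, ringKrullDim_eq_zero_of_field, zero_add,
      Nat.card_eq_fintype_card, Fintype.card_fin]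
    exact_mod_cast hrank
  have hIP : I₀ ≤ P := hP.1.2
  exact (ringKrullDim_le_of_surjective (Ideal.Quotient.factor hIP)
    (Ideal.Quotient.factor_surjective hIP)).trans hdimB

/-! ### Counting top-dimensional components -/

section Count

variable [IsAlgClosed K]

omit [IsAlgClosed K] in
/-- In `K[X]/I(W)` with `DimLE W q`, any `q + 1` elements are algebraically dependent over `K`
(componentwise `trdeg = dim ≤ q`, and `I(W)` is the intersection of its minimal primes).
[folklore] -/
theorem exists_relation_of_dimLE (W : Set (Fin n → K)) {q : ℕ} (hW : DimLE W q)
    (w : Fin (q + 1) → MvPolynomial (Fin n) K ⧸ vanishingIdeal K W) :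
    ∃ F : MvPolynomial (Fin (q + 1)) K, F ≠ 0 ∧ aeval w F = 0 := by
  classical
  have hfin := Ideal.finite_minimalPrimes_of_isNoetherianRing (MvPolynomial (Fin n) K) (vanishingIdeal K W)
  have hP : ∀ P ∈ (vanishingIdeal K W).minimalPrimes, ∃ F : MvPolynomial (Fin (q + 1)) K, F ≠ 0 ∧
      ∀ hle : (vanishingIdeal K W) ≤ P, aeval (fun i => Ideal.Quotient.factorₐ K hle (w i)) F = 0 := by
    intro P hP
    haveI : P.IsPrime := hP.1.1
    haveI : IsDomain (MvPolynomial (Fin n) K ⧸ P) := Ideal.Quotient.isDomain P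
    haveI := finiteType_quotient (K := K) P
    obtain ⟨s, hs, hst⟩ := Literature.RingTheory.KrullDimension.exists_ringKrullDim_eq_and_trdeg_eq
      K (MvPolynomial (Fin n) K ⧸ P)
    have hsq : s ≤ q := natCast_withBot_le_iff.1 (hs ▸ hW P hP)
    have hle : (vanishingIdeal K W) ≤ P := hP.1.2
    by_contra hno
    push Not at hno
    have hind : AlgebraicIndependent K (fun i => Ideal.Quotient.factorₐ K hle (w i)) := by
      rw [AlgebraicIndependent, injective_iff_map_eq_zero]
      intro F hF
      by_contra h0
      obtain ⟨hle', hne⟩ := hno F h0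
      exact hne hF
    have hcard := hind.lift_cardinalMk_le_trdeg
    rw [hst] at hcard
    simp only [Cardinal.mk_fin, Cardinal.lift_natCast] at hcard
    have : q + 1 ≤ s := by exact_mod_cast hcard
    omega
  choose F hF0 hFw using hP
  refine ⟨∏ P ∈ hfin.toFinset.attach, F P.1 (hfin.mem_toFinset.1 P.2), ?_, ?_⟩
  · exact Finset.prod_ne_zero_iff.2 fun P _ => hF0 _ _
  · -- the product vanishes in every `K[X]/P`, hence in `K[X]/I(W)`
    obtain ⟨a, ha⟩ := Ideal.Quotient.mk_surjective
      (aeval w (∏ P ∈ hfin.toFinset.attach, F P.1 (hfin.mem_toFinset.1 P.2)))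
    rw [← ha, Ideal.Quotient.eq_zero_iff_mem]
    have hrad : (vanishingIdeal K W).radical = (vanishingIdeal K W) := (isRadical_vanishingIdeal W).radical
    rw [← hrad, ← Ideal.sInf_minimalPrimes, Ideal.mem_sInf]
    intro P hP
    have hle : (vanishingIdeal K W) ≤ P := hP.1.2
    have h := congrArg (Ideal.Quotient.factorₐ K hle) ha
    rw [map_prod, map_prod, Ideal.Quotient.factorₐ_apply_mk] at h
    have hzero : ∏ x ∈ hfin.toFinset.attach,
        Ideal.Quotient.factorₐ K hle (aeval w (F x.1 (hfin.mem_toFinset.1 x.2))) = 0 := by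
      refine Finset.prod_eq_zero (Finset.mem_attach _ ⟨P, hfin.mem_toFinset.2 hP⟩) ?_
      dsimp only
      rw [← AlgHom.comp_apply, comp_aeval]
      exact hFw P hP hle
    rw [hzero] at h
    exact (Ideal.Quotient.eq_zero_iff_mem).1 h

/-- **Linear Noether normalisation of `K[X]/I(W)`** (from `LinearFamily.lean`, pure existence over
`K`): if `DimLE W q`, `q ≤ n`, there are `q` LINEAR FORMS `λ_1, …, λ_q` such that `K[X]/I(W)` is
integral over `K[λ]` (i.e. the ring map `K[t_1, …, t_q] → K[X]/I(W)`, `t_k ↦ λ_k`, is integral).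
[cite: GreuelPfister2002, Thm. 3.4.1] -/
theorem exists_linearForms_isIntegral (W : Set (Fin n → K)) {q : ℕ} (hW : DimLE W q) (hqn : q ≤ n) :
    ∃ lam : Fin q → MvPolynomial (Fin n) K, (∀ k, (lam k).totalDegree ≤ 1) ∧
      ((Ideal.Quotient.mk (vanishingIdeal K W)).comp
        (aeval lam : MvPolynomial (Fin q) K →ₐ[K] MvPolynomial (Fin n) K).toRingHom).IsIntegral := by
  classical
  set I₀ := vanishingIdeal K W with hI₀
  set y : Fin n → MvPolynomial (Fin n) K ⧸ I₀ := fun i => Ideal.Quotient.mk I₀ (X i) with hy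
  have hint : ∀ b : MvPolynomial (Fin n) K ⧸ I₀, IsIntegral (Algebra.adjoin K (Set.range y)) b :=
    fun b => Literature.RingTheory.NoetherNormalization.isIntegral_of_mem_subalgebra
      (by rw [hy, adjoin_mk_X_eq_top]; trivial)
  obtain ⟨Λ, hΛspan, hΛint⟩ :=
    Literature.RingTheory.NoetherNormalization.exists_linear_noether_normalization (k := K) q n y hqn
      hint (fun w _ => exists_relation_of_dimLE W hW w)
  have hcoef : ∀ k, ∃ c : Fin n → K, ∑ i, c i • y i = Λ k := fun k =>
    (Submodule.mem_span_range_iff_exists_fun K).1 (hΛspan k)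
  choose c hc using hcoef
  set lam : Fin q → MvPolynomial (Fin n) K := fun k => ∑ i, C (c k i) * X i with hlam
  have hmk : ∀ k, Ideal.Quotient.mk I₀ (lam k) = Λ k := by
    intro k
    rw [← hc k, hlam]
    dsimp only
    rw [map_sum]
    refine Finset.sum_congr rfl fun i _ => ?_
    rw [hy]
    change Ideal.Quotient.mkₐ K I₀ (C (c k i) * X i) = c k i • Ideal.Quotient.mkₐ K I₀ (X i)
    rw [← map_smul, MvPolynomial.smul_eq_C_mul]
  refine ⟨lam, fun k => ?_, ?_⟩
  · rw [hlam]
    refine totalDegree_finsetSum_le fun i _ => (totalDegree_mul _ _).trans ?_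
    rw [totalDegree_C, totalDegree_X, zero_add]
  · -- integrality of `ψ = mk ∘ aeval lam` from integrality over `adjoin K (range Λ)`
    set S := Algebra.adjoin K (Set.range Λ) with hS
    have hmemS : ∀ p : MvPolynomial (Fin q) K, aeval Λ p ∈ S := fun p => by
      rw [hS, ← aeval_range]; exact ⟨p, rfl⟩
    set ρ : MvPolynomial (Fin q) K →ₐ[K] S := (aeval Λ).codRestrict S hmemS with hρ
    have hρsurj : Function.Surjective ρ := by
      rintro ⟨s, hs⟩
      rw [hS, ← aeval_range] at hs
      obtain ⟨p, rfl⟩ := hs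
      exact ⟨p, Subtype.ext rfl⟩
    set ψ := (Ideal.Quotient.mk I₀).comp
      (aeval lam : MvPolynomial (Fin q) K →ₐ[K] MvPolynomial (Fin n) K).toRingHom with hψ
    have hψρ : ψ = (algebraMap S (MvPolynomial (Fin n) K ⧸ I₀)).comp
        (ρ : MvPolynomial (Fin q) K →+* S) := by
      refine MvPolynomial.ringHom_ext (fun a => ?_) (fun k => ?_)
      · change Ideal.Quotient.mk I₀ (aeval lam (C a)) =
          ((ρ (C a) : S) : MvPolynomial (Fin n) K ⧸ I₀)
        rw [hρ, AlgHom.coe_codRestrict, aeval_C, aeval_C, Ideal.Quotient.mk_algebraMap]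
      · change Ideal.Quotient.mk I₀ (aeval lam (X k)) =
          ((ρ (X k) : S) : MvPolynomial (Fin n) K ⧸ I₀)
        rw [aeval_X, hρ, AlgHom.coe_codRestrict, aeval_X, hmk]
    intro b
    obtain ⟨p, hpm, hpb⟩ := hΛint b
    obtain ⟨p', hp'⟩ := Polynomial.map_surjective (ρ : MvPolynomial (Fin q) K →+* S) hρsurj p
    obtain ⟨pl, hplmap, -, hplm⟩ :=
      Polynomial.lifts_and_natDegree_eq_and_monic ((Polynomial.mem_lifts p).2 ⟨p', hp'⟩) hpm
    refine ⟨pl, hplm, ?_⟩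
    rw [hψρ, ← Polynomial.eval₂_map, hplmap]
    exact hpb

variable {q : ℕ} (W : Set (Fin n → K)) (lam : Fin q → MvPolynomial (Fin n) K)

omit [IsAlgClosed K] in
/-- The ring map `K[t] → K[X]/Q`, `t_k ↦ λ_k`, for an ideal `Q ⊇ I(W)`, is integral when
`K[t] → K[X]/I(W)` is. [folklore] -/
theorem isIntegral_comp_of_le
    (hint : ((Ideal.Quotient.mk (vanishingIdeal K W)).comp
      (aeval lam : MvPolynomial (Fin q) K →ₐ[K] MvPolynomial (Fin n) K).toRingHom).IsIntegral)
    {Q : Ideal (MvPolynomial (Fin n) K)} (hQ : vanishingIdeal K W ≤ Q) :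
    ((Ideal.Quotient.mk Q).comp
      (aeval lam : MvPolynomial (Fin q) K →ₐ[K] MvPolynomial (Fin n) K).toRingHom).IsIntegral := by
  have h : (Ideal.Quotient.mk Q).comp
      (aeval lam : MvPolynomial (Fin q) K →ₐ[K] MvPolynomial (Fin n) K).toRingHom =
      (Ideal.Quotient.factor hQ).comp ((Ideal.Quotient.mk (vanishingIdeal K W)).comp
        (aeval lam : MvPolynomial (Fin q) K →ₐ[K] MvPolynomial (Fin n) K).toRingHom) := by
    rw [← RingHom.comp_assoc, Ideal.Quotient.factor_comp_mk]
  rw [h]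
  exact hint.trans _ _ (RingHom.isIntegral_of_surjective _ (Ideal.Quotient.factor_surjective hQ))

omit [IsAlgClosed K] in
/-- `eval x ∘ aeval λ = eval (λ(x))` as ring maps `K[t] → K`. [folklore] -/
theorem eval_comp_aeval_eq (x : Fin n → K) (c : Fin q → K) (hc : ∀ k, eval x (lam k) = c k) :
    (eval x).comp (aeval lam : MvPolynomial (Fin q) K →ₐ[K] MvPolynomial (Fin n) K).toRingHom =
      eval c := by
  refine MvPolynomial.ringHom_ext (fun a => ?_) (fun k => ?_)
  · rw [RingHom.comp_apply, AlgHom.toRingHom_eq_coe, AlgHom.coe_toRingHom, aeval_C,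
      MvPolynomial.algebraMap_eq, eval_C, eval_C]
  · rw [RingHom.comp_apply, AlgHom.toRingHom_eq_coe, AlgHom.coe_toRingHom, aeval_X, eval_X]
    exact hc k

omit [IsAlgClosed K] in
/-- Distinct minimal primes are incomparable. [folklore] -/
theorem not_le_of_ne_of_mem_minimalPrimes {I P P' : Ideal (MvPolynomial (Fin n) K)}
    (hP : P ∈ I.minimalPrimes) (hP' : P' ∈ I.minimalPrimes) (hne : P ≠ P') : ¬ P' ≤ P :=
  fun hle => hne (le_antisymm (hP.2 ⟨hP'.1.1, hP'.1.2⟩ hle) hle)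

/-- **Points of a top component over a prescribed value of `λ`** (lying over): if `K[t] → K[X]/I(W)`
is integral and `P` is a minimal prime of `I(W)` of dimension `q`, then `K[t] → K[X]/P` is
injective, and for every `c ∈ K^q` there is a point `x` with `P ⊆ I({x})` (so `x ∈ Z(P) ⊆ W̄`) and
`λ(x) = c`. [folklore] -/
theorem exists_point_of_topPrime
    (hint : ((Ideal.Quotient.mk (vanishingIdeal K W)).comp
      (aeval lam : MvPolynomial (Fin q) K →ₐ[K] MvPolynomial (Fin n) K).toRingHom).IsIntegral)
    {P : Ideal (MvPolynomial (Fin n) K)} (hP : P ∈ topPrimes W q) (c : Fin q → K) :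
    ∃ x : Fin n → K, P ≤ vanishingIdeal K {x} ∧ ∀ k, eval x (lam k) = c k := by
  classical
  haveI hPp : P.IsPrime := hP.1.1.1
  have hIP : vanishingIdeal K W ≤ P := hP.1.1.2
  set ψP := (Ideal.Quotient.mk P).comp
    (aeval lam : MvPolynomial (Fin q) K →ₐ[K] MvPolynomial (Fin n) K).toRingHom with hψP
  have hψPint : ψP.IsIntegral := isIntegral_comp_of_le W lam hint hIP
  -- injectivity of `ψP` by dimension count
  have hinj : RingHom.ker ψP = ⊥ := by
    by_contra hker
    set ψbar := RingHom.kerLift ψP with hψbar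
    have hcomp : ψbar.comp (Ideal.Quotient.mk (RingHom.ker ψP)) = ψP :=
      RingHom.ext fun r => RingHom.kerLift_mk ψP r
    have hψbarint : ψbar.IsIntegral :=
      RingHom.IsIntegral.tower_top (Ideal.Quotient.mk (RingHom.ker ψP)) ψbar
        (by rw [hcomp]; exact hψPint)
    letI : Algebra (MvPolynomial (Fin q) K ⧸ RingHom.ker ψP) (MvPolynomial (Fin n) K ⧸ P) :=
      ψbar.toAlgebra
    haveI : Algebra.IsIntegral (MvPolynomial (Fin q) K ⧸ RingHom.ker ψP)
        (MvPolynomial (Fin n) K ⧸ P) := ⟨fun x => hψbarint x⟩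
    have h1 : ringKrullDim (MvPolynomial (Fin n) K ⧸ P) ≤
        ringKrullDim (MvPolynomial (Fin q) K ⧸ RingHom.ker ψP) :=
      Literature.RingTheory.KrullDimension.ringKrullDim_le_of_isIntegral
    have h2 := Literature.RingTheory.KrullDimension.ringKrullDim_quotient_add_one_le hker
    rw [MvPolynomial.ringKrullDim_of_isNoetherianRing, ringKrullDim_eq_zero_of_field, zero_add,
      Nat.card_eq_fintype_card, Fintype.card_fin] at h2
    rw [hP.2] at h1
    have h3 := (add_le_add h1 (le_refl (1 : WithBot ℕ∞))).trans h2
    have : q + 1 ≤ q := by exact_mod_cast h3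
    omega
  -- lying over
  letI : Algebra (MvPolynomial (Fin q) K) (MvPolynomial (Fin n) K ⧸ P) := ψP.toAlgebra
  haveI : Algebra.IsIntegral (MvPolynomial (Fin q) K) (MvPolynomial (Fin n) K ⧸ P) :=
    ⟨fun x => hψPint x⟩
  set 𝔫 : Ideal (MvPolynomial (Fin q) K) := RingHom.ker (eval c) with h𝔫
  haveI h𝔫max : 𝔫.IsMaximal :=
    RingHom.ker_isMaximal_of_surjective (eval c) fun a => ⟨C a, eval_C a⟩
  have hkerle : RingHom.ker (algebraMap (MvPolynomial (Fin q) K) (MvPolynomial (Fin n) K ⧸ P)) ≤ 𝔫 := by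
    rw [RingHom.algebraMap_toAlgebra, hinj]; exact bot_le
  obtain ⟨𝔐, h𝔐max, h𝔐comap⟩ := Ideal.exists_ideal_over_maximal_of_isIntegral 𝔫 hkerle
  haveI := h𝔐max
  have h𝔐'max : (𝔐.comap (Ideal.Quotient.mk P)).IsMaximal :=
    Ideal.comap_isMaximal_of_surjective _ Ideal.Quotient.mk_surjective
  obtain ⟨x, hx⟩ := (isMaximal_iff_eq_vanishingIdeal_singleton (I := 𝔐.comap (Ideal.Quotient.mk P))).1 h𝔐'max
  refine ⟨x, ?_, fun k => ?_⟩
  · intro p hp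
    rw [← hx, Ideal.mem_comap, Ideal.Quotient.eq_zero_iff_mem.2 hp]
    exact Ideal.zero_mem _
  · have hk : (X k - C (c k) : MvPolynomial (Fin q) K) ∈ 𝔫 := by
      rw [h𝔫, RingHom.mem_ker, map_sub, eval_X, eval_C, sub_self]
    rw [← h𝔐comap, Ideal.mem_comap, RingHom.algebraMap_toAlgebra] at hk
    have hk' : Ideal.Quotient.mk P (lam k - C (c k)) ∈ 𝔐 := by
      have : ψP (X k - C (c k)) = Ideal.Quotient.mk P (lam k - C (c k)) := by
        rw [hψP, RingHom.comp_apply, AlgHom.toRingHom_eq_coe, AlgHom.coe_toRingHom, map_sub,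
          aeval_X, aeval_C, MvPolynomial.algebraMap_eq]
      rw [← this]; exact hk
    have hmem : lam k - C (c k) ∈ vanishingIdeal K ({x} : Set (Fin n → K)) := by
      rw [← hx, Ideal.mem_comap]; exact hk'
    rw [mem_vanishingIdeal_singleton_iff, aeval_eq_eval, map_sub, eval_C, sub_eq_zero] at hmem
    exact hmem

omit [IsAlgClosed K] in
/-- For two DISTINCT top primes `P ≠ P'` the map `K[t] → K[X]/(P + P')` has a non-zero kernel
(its image has dimension `< q = dim K[t]`). [folklore] -/
theorem exists_mem_sup_of_ne
    (hint : ((Ideal.Quotient.mk (vanishingIdeal K W)).comp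
      (aeval lam : MvPolynomial (Fin q) K →ₐ[K] MvPolynomial (Fin n) K).toRingHom).IsIntegral)
    {P P' : Ideal (MvPolynomial (Fin n) K)} (hP : P ∈ topPrimes W q) (hP' : P' ∈ topPrimes W q)
    (hne : P ≠ P') : ∃ jv : MvPolynomial (Fin q) K, jv ≠ 0 ∧ aeval lam jv ∈ P ⊔ P' := by
  classical
  haveI hPp : P.IsPrime := hP.1.1.1
  have hIP : vanishingIdeal K W ≤ P := hP.1.1.2
  set ψ₂ := (Ideal.Quotient.mk (P ⊔ P')).comp
    (aeval lam : MvPolynomial (Fin q) K →ₐ[K] MvPolynomial (Fin n) K).toRingHom with hψ₂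
  have hψ₂int : ψ₂.IsIntegral := isIntegral_comp_of_le W lam hint (hIP.trans le_sup_left)
  suffices hker : RingHom.ker ψ₂ ≠ ⊥ by
    obtain ⟨jv, hjv, hjv0⟩ := Submodule.exists_mem_ne_zero_of_ne_bot hker
    refine ⟨jv, hjv0, ?_⟩
    rw [RingHom.mem_ker, hψ₂, RingHom.comp_apply, Ideal.Quotient.eq_zero_iff_mem] at hjv
    exact hjv
  intro hker
  letI : Algebra (MvPolynomial (Fin q) K) (MvPolynomial (Fin n) K ⧸ (P ⊔ P')) := ψ₂.toAlgebra
  haveI : Algebra.IsIntegral (MvPolynomial (Fin q) K) (MvPolynomial (Fin n) K ⧸ (P ⊔ P')) :=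
    ⟨fun x => hψ₂int x⟩
  have hinj : Function.Injective (algebraMap (MvPolynomial (Fin q) K)
      (MvPolynomial (Fin n) K ⧸ (P ⊔ P'))) := by
    rw [RingHom.injective_iff_ker_eq_bot, RingHom.algebraMap_toAlgebra]; exact hker
  have h1 := Literature.RingTheory.KrullDimension.ringKrullDim_eq_of_isIntegral hinj
  rw [MvPolynomial.ringKrullDim_of_isNoetherianRing, ringKrullDim_eq_zero_of_field, zero_add,
    Nat.card_eq_fintype_card, Fintype.card_fin] at h1
  have hne' : P ≠ P ⊔ P' := fun h =>
    not_le_of_ne_of_mem_minimalPrimes hP.1 hP'.1 hne (by rw [h]; exact le_sup_right)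
  have h2 := ringKrullDim_quotient_add_one_le_of_lt (le_sup_left : P ≤ P ⊔ P') hne'
  rw [hP.2, ← h1] at h2
  have : q + 1 ≤ q := by exact_mod_cast h2
  omega

omit [IsAlgClosed K] in
/-- **Finiteness of the fibres of `λ`**: if `K[t] → K[X]/I(W)` is integral then for every `c` the
set of points of the closure `Z(I(W))` with `λ = c` is finite (each coordinate is a root of a monic
polynomial specialised at `c`). [folklore] -/
theorem finite_zeroLocus_inter_fibre
    (hint : ((Ideal.Quotient.mk (vanishingIdeal K W)).comp
      (aeval lam : MvPolynomial (Fin q) K →ₐ[K] MvPolynomial (Fin n) K).toRingHom).IsIntegral)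
    (c : Fin q → K) :
    {x ∈ zeroLocus K (vanishingIdeal K W) | ∀ k, eval x (lam k) = c k}.Finite := by
  classical
  have hmon : ∀ i : Fin n, ∃ p : Polynomial (MvPolynomial (Fin q) K), p.Monic ∧
      Polynomial.eval₂ (aeval lam : MvPolynomial (Fin q) K →ₐ[K] MvPolynomial (Fin n) K).toRingHom
        (X i) p ∈ vanishingIdeal K W := by
    intro i
    obtain ⟨p, hpm, hp0⟩ := hint (Ideal.Quotient.mk _ (X i))
    refine ⟨p, hpm, ?_⟩
    rw [← Ideal.Quotient.eq_zero_iff_mem, Polynomial.hom_eval₂]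
    exact hp0
  choose p hpm hpI using hmon
  refine (Set.Finite.pi (t := fun i : Fin n => {y : K | ((p i).map (eval c)).eval y = 0})
    fun i => ?_).subset ?_
  · have h0 : (p i).map (eval c) ≠ 0 := ((hpm i).map _).ne_zero
    exact (((p i).map (eval c)).roots.toFinset.finite_toSet).subset fun y hy => by
      simpa [Polynomial.mem_roots h0] using hy
  · rintro x ⟨hxZ, hxc⟩
    rw [Set.mem_univ_pi]
    intro i
    have h := hxZ _ (hpI i)
    rw [aeval_eq_eval, Polynomial.hom_eval₂, eval_X, eval_comp_aeval_eq lam x c hxc] at h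
    show ((p i).map (eval c)).eval (x i) = 0
    rw [Polynomial.eval_map]; exact h

/-- **The number of top-dimensional components is at most `Dⁿ`.** Let `W ⊆ Kⁿ` be the zero set of
`j` polynomials of total degree `< D` (`D ≥ 2`), all of whose components have dimension `≤ q`,
where `j + q = n`. Then `W` has at most `Dⁿ` components of dimension `q` (see the module docstring
for the proof: linear Noether normalisation, lying over, and the Bézout-type count for the square
system `(G, λ - c)`). Compare Bürgisser 2000, Lemma 4.3, where the count `deg V · d^i` comes from
Bézout's inequality. [cite: Burgisser2000TCS, Lemma 4.3 p. 80] -/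
theorem finite_topPrimes_and_ncard_le {j q D : ℕ} (hjq : j + q = n) (hD : 1 < D)
    (G : Fin j → MvPolynomial (Fin n) K) (hG : ∀ i, (G i).totalDegree < D)
    (hW : DimLE {x : Fin n → K | ∀ i, eval x (G i) = 0} q) :
    (topPrimes {x : Fin n → K | ∀ i, eval x (G i) = 0} q).Finite ∧
      (topPrimes {x : Fin n → K | ∀ i, eval x (G i) = 0} q).ncard ≤ D ^ n := by
  classical
  set W : Set (Fin n → K) := {x | ∀ i, eval x (G i) = 0} with hWdef
  set T := topPrimes W q with hT
  have hTfin : T.Finite :=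
    (Ideal.finite_minimalPrimes_of_isNoetherianRing (MvPolynomial (Fin n) K)
      (vanishingIdeal K W)).subset fun P hP => hP.1
  refine ⟨hTfin, ?_⟩
  obtain ⟨lam, hlamdeg, hint⟩ := exists_linearForms_isIntegral W hW (by omega)
  -- nonzero kernel elements for pairs of distinct top primes, and a good value `c`
  set prs := (hTfin.toFinset ×ˢ hTfin.toFinset).filter (fun pp => pp.1 ≠ pp.2) with hprs
  have hpair : ∀ pp ∈ prs, ∃ jv : MvPolynomial (Fin q) K, jv ≠ 0 ∧ aeval lam jv ∈ pp.1 ⊔ pp.2 := by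
    intro pp hpp
    obtain ⟨hmem, hne⟩ := Finset.mem_filter.1 hpp
    obtain ⟨h1, h2⟩ := Finset.mem_product.1 hmem
    exact exists_mem_sup_of_ne W lam hint (hTfin.mem_toFinset.1 h1) (hTfin.mem_toFinset.1 h2) hne
  choose jf hjf0 hjfmem using hpair
  set Ψ : MvPolynomial (Fin q) K := ∏ pp ∈ prs.attach, jf pp.1 pp.2 with hΨ
  have hΨ0 : Ψ ≠ 0 := Finset.prod_ne_zero_iff.2 fun pp _ => hjf0 _ _
  obtain ⟨c, hc⟩ : ∃ c : Fin q → K, eval c Ψ ≠ 0 := by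
    by_contra h
    push Not at h
    exact hΨ0 (MvPolynomial.funext fun x => by rw [h x, map_zero])
  -- the points
  have hpt : ∀ P ∈ T, ∃ x : Fin n → K, P ≤ vanishingIdeal K {x} ∧ ∀ k, eval x (lam k) = c k :=
    fun P hP => exists_point_of_topPrime W lam hint hP c
  choose xP hxP hxc using hpt
  set Zc : Set (Fin n → K) := {x | (∀ i, eval x (G i) = 0) ∧ ∀ k, eval x (lam k) = c k} with hZc
  have hGI : ∀ i, G i ∈ vanishingIdeal K W := fun i x hx => by rw [aeval_eq_eval]; exact hx i
  have hZcfin : Zc.Finite := by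
    refine (finite_zeroLocus_inter_fibre W lam hint c).subset ?_
    rintro x ⟨hxG, hxl⟩
    exact ⟨zeroLocus_vanishingIdeal_le W hxG, hxl⟩
  have hmemZc : ∀ P (hP : P ∈ T), xP P hP ∈ Zc := by
    intro P hP
    refine ⟨fun i => ?_, hxc P hP⟩
    have h := hxP P hP (hP.1.1.2 (hGI i))
    rw [mem_vanishingIdeal_singleton_iff, aeval_eq_eval] at h
    exact h
  -- injectivity of `P ↦ x_P`
  set f : Ideal (MvPolynomial (Fin n) K) → (Fin n → K) := fun P => if h : P ∈ T then xP P h else 0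
    with hf
  have hfT : ∀ P ∈ T, f P ∈ Zc := fun P hP => by rw [hf]; dsimp only; rw [dif_pos hP]; exact hmemZc P hP
  have hfinj : Set.InjOn f T := by
    intro P hP P' hP' hPP'
    by_contra hne
    rw [hf] at hPP'; dsimp only at hPP'; rw [dif_pos hP, dif_pos hP'] at hPP'
    have hpp : (P, P') ∈ prs :=
      Finset.mem_filter.2 ⟨Finset.mem_product.2 ⟨hTfin.mem_toFinset.2 hP, hTfin.mem_toFinset.2 hP'⟩, hne⟩
    have hsup : P ⊔ P' ≤ vanishingIdeal K ({xP P hP} : Set (Fin n → K)) :=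
      sup_le (hxP P hP) (hPP' ▸ hxP P' hP')
    have hv := hsup (hjfmem _ hpp)
    rw [mem_vanishingIdeal_singleton_iff, aeval_eq_eval] at hv
    have hv' : eval c (jf _ hpp) = 0 := by
      rw [← eval_comp_aeval_eq lam (xP P hP) c (hxc P hP), RingHom.comp_apply]
      exact hv
    apply hc
    rw [hΨ, map_prod]
    exact Finset.prod_eq_zero (Finset.mem_attach _ ⟨(P, P'), hpp⟩) hv'
  -- the square system
  set e : Fin j ⊕ Fin q ≃ Fin n := finSumFinEquiv.trans (finCongr hjq) with he
  set Fsq : Fin n → MvPolynomial (Fin n) K := fun i => Sum.elim G (fun k => lam k - C (c k)) (e.symm i)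
    with hFsq
  have hZcF : {x : Fin n → K | ∀ i, eval x (Fsq i) = 0} = Zc := by
    ext x
    constructor
    · intro hx
      refine ⟨fun i => ?_, fun k => ?_⟩
      · have h := hx (e (Sum.inl i))
        rw [hFsq] at h; dsimp only at h; rwa [Equiv.symm_apply_apply] at h
      · have h := hx (e (Sum.inr k))
        rw [hFsq] at h; dsimp only at h
        rw [Equiv.symm_apply_apply, Sum.elim_inr, map_sub, eval_C, sub_eq_zero] at h
        exact h
    · rintro ⟨hxG, hxl⟩ i
      rw [hFsq]; dsimp only
      rcases hs : e.symm i with i' | k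
      · exact hxG i'
      · rw [Sum.elim_inr, map_sub, eval_C, hxl k, sub_self]
  have hdegF : ∀ i, (Fsq i).totalDegree < D := by
    intro i
    rw [hFsq]; dsimp only
    rcases hs : e.symm i with i' | k
    · exact hG i'
    · rw [Sum.elim_inr]
      refine lt_of_le_of_lt (totalDegree_sub _ _) (max_lt (lt_of_le_of_lt (hlamdeg k) hD) ?_)
      rw [totalDegree_C]; omega
  have hfinF : {x : Fin n → K | ∀ i, eval x (Fsq i) = 0}.Finite := by rw [hZcF]; exact hZcfin
  have hcount := card_zeros_le_pow (lt_trans Nat.zero_lt_one hD) Fsq hdegF hfinF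
  have hZcard : Zc.ncard ≤ D ^ n := by
    have : Zc.ncard = hfinF.toFinset.card := by
      rw [Set.ncard_eq_toFinset_card Zc hZcfin]
      congr 1
      simp [hZcF]
    rw [this]; exact hcount
  exact (Set.ncard_le_ncard_of_injOn f hfT hfinj hZcfin).trans hZcard



end Count

end Literature.RingTheory.Elimination
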